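import Summits.Ventures.PercRepro.ProfilePointedCircuitClassesGenericTwoTools

/-!
# PercRepro — THE CLASS `#C = ν − 2` AT EVERY NULLITY, II: TYPE (ii) (p5, gen 37; generic in `ν ≥ 3`)

`card_typeII_gen_le`: a demand `W' = C + p' + q'` with `W' ∩ W = C` goes to the unit `(E − x) ∖ ((W' ∖ C) ∪ S)`, `S ⊆ T`
a `(ν − 2)`-set whose removal from `E ∖ (W' ∖ C)` costs at most one rank; the image meets `T` in two points.
-/

open scoped Matroid

namespace PercRepro.Cogirth

open Finset ThmH Skew Shadow Profile

variable {α : Type} [DecidableEq α] {N : Matroid α} [N.Finite]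

section GenericTwoII

/-- **THE TYPE-(ii) DEMANDS** (`W' ∩ W = C`; generic in `ν`): `W' ↦ (E − x) ∖ ((W' ∖ C) ∪ S)` with `S ⊆ T` a `(ν − 2)`-set whose
removal from `X := E ∖ (W' ∖ C)` costs at most one rank (`exists_subset_card_rk_le_sdiff_add_one`); the image meets `T` in two points and determines `W' ∖ C = V ∖ image`. -/
theorem card_typeII_gen_le
    {ν : ℕ} (hν : 3 ≤ ν) (hn : (gr N).card = rk N (gr N) + ν) (x : α) {C W V : Finset α} (Dv Uw : Finset (Finset α))
    (hC : C.card = ν - 2) (hWcard : W.card = ν) (_hxV : x ∉ V) (hVg : V ⊆ gr N) (hVE : V ⊆ (gr N).erase x) (hVcard : V.card = (gr N).card - (ν + 1)) (hVrk : rk N V = V.card)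
    (hCW : C ⊆ W) (hTν : ((gr N).erase x \ V).card = ν) (hTg : (gr N).erase x \ V ⊆ gr N)
    (hTV : ∀ t ∈ (gr N).erase x \ V, t ∉ V) (hTW : ∀ t ∈ (gr N).erase x \ V, t ∉ W)
    (hdem' : ∀ W' ∈ Dv, C ⊆ W' ∧ W'.card = ν ∧ W' ⊆ V ∧ rk N (gr N \ W') = (gr N \ W').card)
    (hspan' : ∀ W' ∈ Dv, ∀ S ⊆ W', rk N (gr N \ S) = rk N (gr N))
    (hunit' : ∀ T' : Finset α, T' ⊆ (gr N).erase x \ W → T'.card = ν →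
      rk N (gr N) ≤ rk N (gr N \ T') + 1 → (gr N).erase x \ T' ∈ Uw) :
    (Dv.filter (fun W' => ¬ W' = W ∧ ¬ (W' ∩ W).card = ν - 1)).card ≤
      (Uw.filter (fun V' => (V' ∩ ((gr N).erase x \ V)).card = 2)).card := by
  apply card_le_card_of_forall_subsingleton (fun W' V' => V \ V' = W' \ C)
  · intro W' hW'
    rw [mem_filter] at hW'
    obtain ⟨hW'Dv, hne, h4⟩ := hW'
    obtain ⟨hCW', hc', hsub', hcompl'⟩ := hdem' W' hW'Dv
    -- `W' ∩ W = C`: the intersection contains `C`, has at most `3` points unless `W' = W`, and is not `3`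
    have hint : W' ∩ W = C := by
      have hsubI : C ⊆ W' ∩ W := subset_inter hCW' hCW
      have hleν : (W' ∩ W).card ≤ ν := (card_le_card inter_subset_left).trans (le_of_eq hc')
      have hneν : (W' ∩ W).card ≠ ν := by
        intro h5
        apply hne
        have hWsub : W' ⊆ W := by
          have : W' ∩ W = W' := eq_of_subset_of_card_le inter_subset_left (by omega)
          rw [← this]; exact inter_subset_right
        exact eq_of_subset_of_card_le hWsub (by omega)
      have hgeν : ν - 2 ≤ (W' ∩ W).card := hC ▸ card_le_card hsubI
      exact (eq_of_subset_of_card_le hsubI (by omega)).symm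
    have hPV : W' \ C ⊆ V := sdiff_subset.trans hsub'
    have hPW : ∀ a ∈ W' \ C, a ∉ W := by
      intro a ha haW
      have : a ∈ W' ∩ W := mem_inter.2 ⟨(mem_sdiff.1 ha).1, haW⟩
      rw [hint] at this
      exact (mem_sdiff.1 ha).2 this
    have hP2 : (W' \ C).card = 2 := by rw [card_sdiff_of_subset hCW']; omega
    -- `t₁ ∈ T` not a coloop of `E ∖ (W' ∖ C)`
    have hTX : (gr N).erase x \ V ⊆ gr N \ (W' \ C) := fun t ht =>
      mem_sdiff.2 ⟨hTg ht, fun h => hTV t ht (hPV h)⟩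
    have hrkX : rk N (gr N \ (W' \ C)) ≤ rk N ((gr N \ (W' \ C)) \ ((gr N).erase x \ V)) + 3 := by
      have h1 : rk N (gr N \ (W' \ C)) = rk N (gr N) := hspan' W' hW'Dv (W' \ C) sdiff_subset
      have h2 : V \ (W' \ C) ⊆ (gr N \ (W' \ C)) \ ((gr N).erase x \ V) := by
        intro a ha
        rw [mem_sdiff] at ha ⊢
        exact ⟨mem_sdiff.2 ⟨hVg ha.1, ha.2⟩, fun h => hTV a h ha.1⟩
      have h3 : rk N (V \ (W' \ C)) = (V \ (W' \ C)).card :=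
        rk_eq_card_of_subset_of_rk_eq_card sdiff_subset hVrk
      have h4 := rk_le_rk_of_subset_finset (M := N) h2
      rw [h3, card_sdiff_of_subset hPV, hVcard, hP2] at h4
      omega
    -- `S ⊆ T` of `ν − 2` points with `ρ(E ∖ ((W' ∖ C) ∪ S)) ≥ ρ(E) − 1`
    have hXg : gr N \ (W' \ C) ⊆ gr N := sdiff_subset
    obtain ⟨S, hST, hScard, hrkS⟩ := exists_subset_card_rk_le_sdiff_add_one hXg hTX hrkX
      (m := ν - 2) (by omega) (by omega)
    have hsubT : S ⊆ (gr N).erase x \ V := hST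
    -- the hole `T' := (W' ∖ C) ∪ S` and the unit `(E − x) ∖ T'`
    set T' := (W' \ C) ∪ S with hT'
    have hT'S : T' ⊆ (gr N).erase x \ W := by
      intro a ha
      rw [hT', mem_union] at ha
      rw [mem_sdiff]
      rcases ha with ha | ha
      · exact ⟨hVE (hPV ha), hPW a ha⟩
      · have haT := hsubT ha
        exact ⟨(mem_sdiff.1 haT).1, hTW _ haT⟩
    have hT'ν : T'.card = ν := by
      rw [hT', card_union_of_disjoint, hP2, hScard]
      · omega
      · rw [disjoint_left]
        intro a ha hb
        exact hTV _ (hsubT hb) (hPV ha)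
    have hrkT' : rk N (gr N) ≤ rk N (gr N \ T') + 1 := by
      have e1 : gr N \ T' = (gr N \ (W' \ C)) \ S := by
        rw [hT']
        ext a
        simp only [mem_sdiff, mem_union, not_or]
        tauto
      have h1 : rk N (gr N \ (W' \ C)) = rk N (gr N) := hspan' W' hW'Dv (W' \ C) sdiff_subset
      rw [e1, ← h1]
      exact hrkS
    have hmem := hunit' T' hT'S hT'ν hrkT'
    refine ⟨(gr N).erase x \ T', ?_, ?_⟩
    · rw [mem_filter]
      refine ⟨hmem, ?_⟩
      have e : ((gr N).erase x \ T') ∩ ((gr N).erase x \ V) = ((gr N).erase x \ V) \ S := by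
        rw [hT']
        ext a
        simp only [mem_inter, mem_sdiff, mem_union, not_or]
        constructor
        · rintro ⟨⟨hax, haP, hat⟩, _, haV⟩
          exact ⟨⟨hax, haV⟩, hat⟩
        · rintro ⟨⟨hax, haV⟩, hat⟩
          exact ⟨⟨hax, fun h => haV (hPV (mem_sdiff.2 h)), hat⟩, hax, haV⟩
      rw [e, card_sdiff_of_subset hsubT, hScard, hTν]
      omega
    · -- `V ∖ ((E − x) ∖ T') = W' ∖ C`
      ext a
      constructor
      · intro ha
        rw [mem_sdiff] at ha
        obtain ⟨haV, hnot⟩ := ha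
        have haT' : a ∈ T' := by
          by_contra h
          exact hnot (mem_sdiff.2 ⟨hVE haV, h⟩)
        rw [hT', mem_union] at haT'
        rcases haT' with h | h
        · exact h
        · exact absurd haV (hTV _ (hsubT h))
      · intro ha
        rw [mem_sdiff]
        refine ⟨hPV ha, fun h => (mem_sdiff.1 h).2 ?_⟩
        rw [hT', mem_union]
        exact Or.inl ha
  · intro V' hV' W₁ hW₁ W₂ hW₂
    simp only [Set.mem_setOf_eq, mem_filter] at hW₁ hW₂
    obtain ⟨hCW₁, _, _, _⟩ := hdem' W₁ hW₁.1.1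
    obtain ⟨hCW₂, _, _, _⟩ := hdem' W₂ hW₂.1.1
    rw [← sdiff_union_of_subset hCW₁, ← sdiff_union_of_subset hCW₂, ← hW₁.2, ← hW₂.2]




end GenericTwoII

end PercRepro.Cogirth
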